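/-
Copyright (c) 2026. All rights reserved.
Released under Apache 2.0 license as described in the file LICENSE.
Authors: abc-iut cell, fact-proving seat abc-iut-f-087 (block F, tranche 87); v2 = docstring-only
quotation corrections after RQ7 (aud-6) and lane-K (ref-k K23-n2) reads, declarations byte-identical.
-/
import Mathlib.Data.Set.Defs
import Literature.AnabelianGeometry.AbsoluteAnabelian.AbsTopIII.MonoAnabelianComparisonShapes

/-!
# [AbsTopIII] Corollary 3.7: the vertex sets `Γ⃗_{<□}`, `𝒟‡_{≤n}`, `𝒟†_{≤n}` of the quiver `Γ⃗_{𝒟*}` —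
# characterisations, instance forms, and the refuted universal closures

S. Mochizuki, *Topics in absolute anabelian geometry III: global reconstruction algorithms*,
J. Math. Sci. Univ. Tokyo 22 (2015) 939–1156 [MochizukiAbsTopIII2015]; locators `p.N` = pages of the
author's manuscript, as in the file this one accompanies (Cor 3.7 pp. 86–88: the diagram `𝒟†` and
its sub-diagrams `𝒟†_{≤n}` p. 86, `𝒟‡` / `𝒟‡_{≤n}` / `𝒟*` p. 87, item (v) — the nexus `□` and the
`ℤ`-translation — p. 88).

PROOF-ONLY companion of `MonoAnabelianComparisonShapes.lean` (statement-typer abc-iut-L4-t9), which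
is imported and never restated. That file realises the oriented graph `Γ⃗_{𝒟*}` of Cor 3.7 (ii) as
the explicit quiver `Cor37Vertex` / `Cor37Edge` and declares three MEMBERSHIP PREDICATES on vertices:

* `Cor37Vertex.BelowBox a` (`a.row = 1`): the pre-nexus side `Γ⃗_{<□}` of Cor 3.7 (v) — the first
  row, i.e. the copies `⋎ ∈ L` of `𝒳 ×_𝔈 𝒳` and the core vertex `ref`;
* `Cor37Vertex.InDDaggerLe n a` (`a.row ≤ n`): the vertices of `𝒟‡_{≤n}` — print, p. 87: "`𝒟‡_{≤n}`
  [where `n ∈ {1, 2, 3, 4}`] for the subdiagram of `𝒟‡` constituted by `𝒟†_{≤n}`, together with the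
  newly appended arrows `π_⋎`"; at the level of VERTICES (all this file sees) these are the vertices
  of `𝒟†_{≤n}` together with the common codomain of the arrows `π_⋎`, i.e. the "new 'core' vertex
  lying in the first row of `𝒟‡`" (p. 87) — equivalently the first `n` rows of `𝒟*`, which has the
  same vertices as `𝒟‡`;
* `Cor37Vertex.InDaggerLe n a` (`a ≠ ref ∧ a.row ≤ n`): the vertices of `𝒟†_{≤n}`, the sub-diagram of
  the first `n` rows of `𝒟†` — Cor 3.7 is stated "in the notation and conventions of Corollary 3.6"
  (p. 86), and Cor 3.6 (p. 79) writes "`𝒟_{≤n}` [for] the subdiagram of categories of `𝒟` determined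
  by the first `n` [of the six] rows of `𝒟`"; p. 86 itself uses `𝒟†_{≤1}`, p. 87 `𝒟† = 𝒟†_{≤4}`,
  `𝒟†_{≤3}`, `𝒟†_{≤2}`, without restating the convention.

The cell's frozen FACT-LIST carries them as the parametrised rows F-0390 (`BelowBox`), F-0391
(`InDDaggerLe`) and F-0393 (`InDaggerLe`). A membership predicate is VOCABULARY, not a claim: its
one-step-unfolded universal closure is false, and what consumers (`BiAnabelianDiagrams.lean`,
`BiAnabelianNexusProofs.lean`, `BiAnabelianCoresProofs.lean`, `BiAnabelianIncompatibility.lean`,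
`BiAnabelianTelecoreFamily.lean`) use are its instances, as set-builder vertex sets. This file records
exactly that, kernel-checked (the same disposition as the sibling row F-0392 `InDagger`):

1. the three universal closures are REFUTED: `Cor37Vertex.not_forall_belowBox` (witness the nexus
   `□`, row 2), `Cor37Vertex.not_forall_inDDaggerLe` (witness `n = 0`: rows start at 1),
   `Cor37Vertex.not_forall_inDaggerLe` (witness the core vertex `ref`, which lies in no `𝒟†_{≤n}`),
   with the sharp forms `(∀ a, a.InDDaggerLe n) ↔ 4 ≤ n` and `∀ n, ¬ ∀ a, a.InDaggerLe n`;
2. complete per-vertex characterisations (`first m`, `□`, `𝒩`, `𝔈`, `ref`) of the three predicates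
   as `iff`s in `n`, so that every instance form is decided — among them the fourth sibling
   `galois_inDaggerLe` of abc-iut-L4-t9's `first_inDaggerLe` / `box_inDaggerLe` / `space_inDaggerLe`
   (`BiAnabelianDiagrams.lean`) and `not_ref_inDaggerLe`;
3. the TRUE closed instances: `𝒟‡_{≤4}` has every vertex (`inDDaggerLe_four`); `𝒟†_{≤4} = 𝒟†`
   (`inDaggerLe_four_iff_inDagger`); `Γ⃗_{<□}` is the vertex set of `𝒟‡_{≤1}` (= of `𝒟‡_δ`)
   (`belowBox_iff_inDDaggerLe_one`, `setOf_belowBox_eq`); `𝒟‡_{≤n} = 𝒟†_{≤n} ∪ {ref}` for `n ≥ 1`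
   (`inDDaggerLe_iff_inDaggerLe_or`); `{a | a.InDDaggerLe n}` is literally the vertex set
   `{a | a.row ≤ n}` over which `BiAnabelianSetting.starLe n` restricts `𝒟*` (`setOf_inDDaggerLe_eq`);
4. structure: each sub-diagram is closed under SOURCES of edges (`Cor37Edge.source_inDDaggerLe`,
   `Cor37Edge.source_inDaggerLe`: the sub-diagram of the first `n` rows loses no incoming arrow, by
   `Cor37Edge.row_monotone` / `Cor37Edge.inDagger_endpoints`), the edges of `𝒟†` are edges of `𝒟‡`
   (`Cor37Edge.InDagger.inDDagger`), and the `ℤ`-translation `Cor37Vertex.shiftObj` of Cor 3.7 (v)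
   preserves all three predicates.

Quotation policy (v2, after the RQ7 / lane-K reads of v1: aud-6 (d1)(d2), ref-k K23-n2 (A)(B)):
text inside "…" quotation marks is VERBATIM print read on the kurims render (page given next to it);
glosses of ours stand outside quotation marks. v1's two recomposed pseudo-quotes (the `𝒟‡_{≤n}`
sentence with "core vertex" substituted for print's "arrows `π_⋎`", and Cor 3.6's "determined by the
first `n` rows" phrase re-attributed to p. 86) and the p. 88 locator of the "unique vertex of the
second row" bracket (print: p. 87) are corrected in this revision; no declaration, statement or proof
changed.

Refereed pre-IUT anabelian geometry; nothing here bears on [IUTchIII] Cor. 3.12. No side taken; a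
FACT-LIST row is an assumption label, not an endorsement; "proved" = our kernel check of the
statements below and nothing more.
-/

set_option autoImplicit false

namespace Literature.AnabelianGeometry.AbsoluteAnabelian.AbsTopIII

universe w

namespace Cor37Vertex

/-! ## Rows of `Γ⃗_{𝒟*}` -/

/-- The copies `⋎` of `𝒳 ×_𝔈 𝒳` form the first row. [cite: MochizukiAbsTopIII2015, Cor 3.7 p.86] -/
@[simp] theorem row_first (n : ℤ) : (first n).row = 1 := rfl

/-- `□` is the second row: "the vertex at `□` [i.e., the unique vertex of the second row of `𝒟‡`]"
(p. 87); item (v), p. 88, says "The vertex `□` of the second row of `𝒟*`".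
[cite: MochizukiAbsTopIII2015, Cor 3.7 p.87] -/
@[simp] theorem row_box : box.row = 2 := rfl

/-- The `𝒩`-vertex is the third row. [cite: MochizukiAbsTopIII2015, Cor 3.7 p.86] -/
@[simp] theorem row_space : space.row = 3 := rfl

/-- The `𝔈`-vertex is the fourth row. [cite: MochizukiAbsTopIII2015, Cor 3.7 p.86] -/
@[simp] theorem row_galois : galois.row = 4 := rfl

/-- The core vertex `ref` is "a new 'core' vertex lying in the first row of `𝒟‡`".
[cite: MochizukiAbsTopIII2015, Cor 3.7 p.87] -/
@[simp] theorem row_ref : ref.row = 1 := rfl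

/-- Rows are numbered from `1`: every vertex of `Γ⃗_{𝒟*}` has row `≥ 1`.
[cite: MochizukiAbsTopIII2015, Cor 3.7 p.86] -/
theorem one_le_row (a : Cor37Vertex) : 1 ≤ a.row := by
  cases a <;> simp

/-- `𝒟*` (like `𝒟† = 𝒟†_{≤4}`) has four rows: every vertex has row `≤ 4`.
[cite: MochizukiAbsTopIII2015, Cor 3.7 p.86] -/
theorem row_le_four (a : Cor37Vertex) : a.row ≤ 4 := by
  cases a <;> simp

/-! ## `Γ⃗_{<□}`: the predicate `BelowBox` (FACT-LIST row F-0390) -/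

/-- `BelowBox` unfolded: a vertex lies on the pre-nexus side `Γ⃗_{<□}` iff it lies in row `1`.
[cite: MochizukiAbsTopIII2015, Cor 3.7 (v) p.88] -/
theorem belowBox_iff_row_eq_one (a : Cor37Vertex) : a.BelowBox ↔ a.row = 1 := Iff.rfl

/-- Instance form: every copy `⋎ ∈ L` of `𝒳 ×_𝔈 𝒳` lies on the pre-nexus side `Γ⃗_{<□}`.
[cite: MochizukiAbsTopIII2015, Cor 3.7 (v) p.88] -/
@[simp] theorem first_belowBox (n : ℤ) : (first n).BelowBox := rfl

/-- Instance form: the core vertex lies on the pre-nexus side `Γ⃗_{<□}`.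
[cite: MochizukiAbsTopIII2015, Cor 3.7 (v) p.88] -/
@[simp] theorem ref_belowBox : ref.BelowBox := rfl

/-- Instance form: the nexus `□` itself is not on the pre-nexus side.
[cite: MochizukiAbsTopIII2015, Cor 3.7 (v) p.88] -/
@[simp] theorem not_box_belowBox : ¬ box.BelowBox := by decide

/-- Instance form: `𝒩` (row 3) is not on the pre-nexus side.
[cite: MochizukiAbsTopIII2015, Cor 3.7 (v) p.88] -/
@[simp] theorem not_space_belowBox : ¬ space.BelowBox := by decide

/-- Instance form: `𝔈` (row 4) is not on the pre-nexus side.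
[cite: MochizukiAbsTopIII2015, Cor 3.7 (v) p.88] -/
@[simp] theorem not_galois_belowBox : ¬ galois.BelowBox := by decide

/-- `Γ⃗_{<□}` is exactly the first row: the copies of `𝒳 ×_𝔈 𝒳` and the core vertex `ref`.
[cite: MochizukiAbsTopIII2015, Cor 3.7 (v) p.88] -/
theorem belowBox_iff (a : Cor37Vertex) : a.BelowBox ↔ (∃ n, a = first n) ∨ a = ref := by
  cases a <;> simp [BelowBox]

/-- **FACT-LIST F-0390: universal closure REFUTED.** `BelowBox` is a membership predicate, not a
claim; its one-step-unfolded universal closure "every vertex of `Γ⃗_{𝒟*}` lies on the pre-nexus side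
`Γ⃗_{<□}`" is false — the nexus `□` (row 2) is a witness (so are `𝒩` and `𝔈`).
[cite: MochizukiAbsTopIII2015, Cor 3.7 (v) p.88] -/
theorem not_forall_belowBox : ¬ ∀ a : Cor37Vertex, a.BelowBox :=
  fun h => not_box_belowBox (h box)

/-- A pre-nexus vertex is not the nexus `□`. [cite: MochizukiAbsTopIII2015, Cor 3.7 (v) p.88] -/
theorem BelowBox.ne_box {a : Cor37Vertex} (h : a.BelowBox) : a ≠ box := by
  rintro rfl
  exact not_box_belowBox h

/-- The two sides `Γ⃗_{<□}`, `Γ⃗_{>□}` of the nexus are disjoint (pointwise form of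
`belowBox_aboveBox_partition`). [cite: MochizukiAbsTopIII2015, Cor 3.7 (v) p.88] -/
theorem BelowBox.not_aboveBox {a : Cor37Vertex} (h : a.BelowBox) : ¬ a.AboveBox :=
  fun h' => belowBox_aboveBox_partition.2.1 a ⟨h, h'⟩

/-- Off the nexus, a vertex not on the pre-nexus side is on the post-nexus side (pointwise form of
`belowBox_aboveBox_partition`). [cite: MochizukiAbsTopIII2015, Cor 3.7 (v) p.88] -/
theorem aboveBox_of_not_belowBox {a : Cor37Vertex} (ha : a ≠ box) (h : ¬ a.BelowBox) : a.AboveBox :=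
  ((belowBox_aboveBox_partition.1 a).1 ha).resolve_left h

/-- `Γ⃗_{<□}` is the vertex set of `𝒟‡_{≤1}` (which is also that of `𝒟‡_δ`): row `= 1` iff row `≤ 1`,
as rows are numbered from `1`. [cite: MochizukiAbsTopIII2015, Cor 3.7 p.87] -/
theorem belowBox_iff_inDDaggerLe_one (a : Cor37Vertex) : a.BelowBox ↔ a.InDDaggerLe 1 := by
  cases a <;> simp [BelowBox, InDDaggerLe]

/-- Set form of `belowBox_iff_inDDaggerLe_one`: the pre-nexus vertex set `{a | a.BelowBox}` (the one
`Cor37Vertex.box_isNexus` is stated with) equals the vertex set of `𝒟‡_{≤1}`.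
[cite: MochizukiAbsTopIII2015, Cor 3.7 (v) p.88] -/
theorem setOf_belowBox_eq : {a : Cor37Vertex | a.BelowBox} = {a : Cor37Vertex | a.InDDaggerLe 1} :=
  Set.ext belowBox_iff_inDDaggerLe_one

/-- The `ℤ`-translation of Cor 3.7 (v) preserves the pre-nexus side `Γ⃗_{<□}`.
[cite: MochizukiAbsTopIII2015, Cor 3.7 (v) p.88] -/
theorem belowBox_shiftObj_iff (k : ℤ) (a : Cor37Vertex) : (shiftObj k a).BelowBox ↔ a.BelowBox := by
  rw [belowBox_iff_row_eq_one, belowBox_iff_row_eq_one, shiftObj_row]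

/-! ## `𝒟‡_{≤n}`: the predicate `InDDaggerLe` (FACT-LIST row F-0391) -/

/-- `InDDaggerLe` unfolded: a vertex lies in `𝒟‡_{≤n}` iff its row is `≤ n`.
[cite: MochizukiAbsTopIII2015, Cor 3.7 p.87] -/
theorem inDDaggerLe_iff_row_le (n : ℕ) (a : Cor37Vertex) : a.InDDaggerLe n ↔ a.row ≤ n := Iff.rfl

/-- The vertex set `{a | a.InDDaggerLe n}` of `𝒟‡_{≤n}` is literally the set `{a | a.row ≤ n}` over
which `BiAnabelianSetting.starLe n` (`BiAnabelianDiagrams.lean`) restricts the diagram of categories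
`𝒟*` to its first `n` rows. [cite: MochizukiAbsTopIII2015, Cor 3.7 p.87] -/
theorem setOf_inDDaggerLe_eq (n : ℕ) :
    {a : Cor37Vertex | a.InDDaggerLe n} = {a : Cor37Vertex | a.row ≤ n} := rfl

/-- `𝒟‡_{≤m} ⊆ 𝒟‡_{≤n}` for `m ≤ n`. [cite: MochizukiAbsTopIII2015, Cor 3.7 p.87] -/
theorem InDDaggerLe.mono {m n : ℕ} {a : Cor37Vertex} (h : a.InDDaggerLe m) (hmn : m ≤ n) :
    a.InDDaggerLe n :=
  Nat.le_trans h hmn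

/-- Instance form: a copy `⋎` of `𝒳 ×_𝔈 𝒳` lies in `𝒟‡_{≤n}` iff `1 ≤ n`.
[cite: MochizukiAbsTopIII2015, Cor 3.7 p.87] -/
@[simp] theorem first_inDDaggerLe_iff (m : ℤ) (n : ℕ) : (first m).InDDaggerLe n ↔ 1 ≤ n := by
  simp [InDDaggerLe]

/-- Instance form: the core vertex lies in `𝒟‡_{≤n}` iff `1 ≤ n` ("lying in the first row of `𝒟‡`").
[cite: MochizukiAbsTopIII2015, Cor 3.7 p.87] -/
@[simp] theorem ref_inDDaggerLe_iff (n : ℕ) : ref.InDDaggerLe n ↔ 1 ≤ n := by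
  simp [InDDaggerLe]

/-- Instance form: the nexus `□` lies in `𝒟‡_{≤n}` iff `2 ≤ n`.
[cite: MochizukiAbsTopIII2015, Cor 3.7 p.87] -/
@[simp] theorem box_inDDaggerLe_iff (n : ℕ) : box.InDDaggerLe n ↔ 2 ≤ n := by
  simp [InDDaggerLe]

/-- Instance form: `𝒩` lies in `𝒟‡_{≤n}` iff `3 ≤ n`. [cite: MochizukiAbsTopIII2015, Cor 3.7 p.87] -/
@[simp] theorem space_inDDaggerLe_iff (n : ℕ) : space.InDDaggerLe n ↔ 3 ≤ n := by
  simp [InDDaggerLe]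

/-- Instance form: `𝔈` lies in `𝒟‡_{≤n}` iff `4 ≤ n`. [cite: MochizukiAbsTopIII2015, Cor 3.7 p.87] -/
@[simp] theorem galois_inDDaggerLe_iff (n : ℕ) : galois.InDDaggerLe n ↔ 4 ≤ n := by
  simp [InDDaggerLe]

/-- `𝒟‡_{≤0}` has no vertex (rows are numbered from `1`; print only uses `n ∈ {1, 2, 3, 4}`).
[cite: MochizukiAbsTopIII2015, Cor 3.7 p.87] -/
@[simp] theorem not_inDDaggerLe_zero (a : Cor37Vertex) : ¬ a.InDDaggerLe 0 := by
  cases a <;> simp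

/-- TRUE closed instance of F-0391: `𝒟‡_{≤4}` — all four rows, i.e. the whole of `𝒟‡` / `𝒟*` —
contains every vertex. [cite: MochizukiAbsTopIII2015, Cor 3.7 p.87] -/
@[simp] theorem inDDaggerLe_four (a : Cor37Vertex) : a.InDDaggerLe 4 := row_le_four a

/-- Sharp threshold for the universal closure of F-0391 at fixed `n`: every vertex lies in `𝒟‡_{≤n}`
iff `4 ≤ n` (`𝔈` is in row 4). [cite: MochizukiAbsTopIII2015, Cor 3.7 p.87] -/
theorem forall_inDDaggerLe_iff (n : ℕ) : (∀ a : Cor37Vertex, a.InDDaggerLe n) ↔ 4 ≤ n :=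
  ⟨fun h => (galois_inDDaggerLe_iff n).1 (h galois), fun hn a => (inDDaggerLe_four a).mono hn⟩

/-- **FACT-LIST F-0391: universal closure REFUTED.** `InDDaggerLe` is a membership predicate, not a
claim; its one-step-unfolded universal closure "every vertex lies in every `𝒟‡_{≤n}`" is false —
witness `n = 0` (no vertex has row `≤ 0`; equally `n ≤ 3` with the vertex `𝔈`).
[cite: MochizukiAbsTopIII2015, Cor 3.7 p.87] -/
theorem not_forall_inDDaggerLe : ¬ ∀ (n : ℕ) (a : Cor37Vertex), a.InDDaggerLe n :=
  fun h => not_inDDaggerLe_zero box (h 0 box)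

/-- `𝒟†_{≤n} ⊆ 𝒟‡_{≤n}` on vertices. [cite: MochizukiAbsTopIII2015, Cor 3.7 p.87] -/
theorem InDaggerLe.inDDaggerLe {n : ℕ} {a : Cor37Vertex} (h : a.InDaggerLe n) : a.InDDaggerLe n :=
  h.2

/-- Vertex-level reading of "`𝒟‡_{≤n}` … the subdiagram of `𝒟‡` constituted by `𝒟†_{≤n}`, together
with the newly appended arrows `π_⋎`" (p. 87): the vertices of `𝒟‡_{≤n}` are those of `𝒟†_{≤n}`
together with the codomain of the `π_⋎`, the core vertex `ref` (a first-row vertex, so present from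
`n = 1` on). [cite: MochizukiAbsTopIII2015, Cor 3.7 p.87] -/
theorem inDDaggerLe_iff_inDaggerLe_or (n : ℕ) (a : Cor37Vertex) :
    a.InDDaggerLe n ↔ a.InDaggerLe n ∨ (a = ref ∧ 1 ≤ n) := by
  cases a <;> simp [InDDaggerLe, InDaggerLe, InDagger]

/-- The `ℤ`-translation of Cor 3.7 (v) preserves each `𝒟‡_{≤n}` (it preserves rows).
[cite: MochizukiAbsTopIII2015, Cor 3.7 (v) p.88] -/
theorem inDDaggerLe_shiftObj_iff (k : ℤ) (n : ℕ) (a : Cor37Vertex) :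
    (shiftObj k a).InDDaggerLe n ↔ a.InDDaggerLe n := by
  rw [inDDaggerLe_iff_row_le, inDDaggerLe_iff_row_le, shiftObj_row]

/-! ## `𝒟†_{≤n}`: the predicate `InDaggerLe` (FACT-LIST row F-0393) -/

/-- `InDaggerLe` unfolded: a vertex lies in `𝒟†_{≤n}` iff it is a vertex of `𝒟†` (i.e. not the core
vertex of `𝒟‡`) of row `≤ n`. [cite: MochizukiAbsTopIII2015, Cor 3.7 p.86] -/
theorem inDaggerLe_iff (n : ℕ) (a : Cor37Vertex) : a.InDaggerLe n ↔ a ≠ ref ∧ a.row ≤ n := Iff.rfl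

/-- A vertex of `𝒟†_{≤n}` is a vertex of `𝒟†`. [cite: MochizukiAbsTopIII2015, Cor 3.7 p.86] -/
theorem InDaggerLe.inDagger {n : ℕ} {a : Cor37Vertex} (h : a.InDaggerLe n) : a.InDagger := h.1

/-- A vertex of `𝒟†_{≤n}` has row `≤ n`. [cite: MochizukiAbsTopIII2015, Cor 3.7 p.86] -/
theorem InDaggerLe.row_le {n : ℕ} {a : Cor37Vertex} (h : a.InDaggerLe n) : a.row ≤ n := h.2

/-- `𝒟†_{≤m} ⊆ 𝒟†_{≤n}` for `m ≤ n` (`𝒟†_{≤1} ⊆ 𝒟†_{≤2} ⊆ 𝒟†_{≤3} ⊆ 𝒟†_{≤4} = 𝒟†`).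
[cite: MochizukiAbsTopIII2015, Cor 3.7 p.86] -/
theorem InDaggerLe.mono {m n : ℕ} {a : Cor37Vertex} (h : a.InDaggerLe m) (hmn : m ≤ n) :
    a.InDaggerLe n :=
  ⟨h.1, Nat.le_trans h.2 hmn⟩

/-- Instance form: the core vertex `ref` — "a new 'core' vertex lying in the first row of `𝒟‡`"
(p. 87), not a vertex of `𝒟†` — lies in NO `𝒟†_{≤n}`. [cite: MochizukiAbsTopIII2015, Cor 3.7 p.87] -/
@[simp] theorem not_ref_inDaggerLe (n : ℕ) : ¬ ref.InDaggerLe n := fun h => h.1 rfl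

/-- Instance form: a copy `⋎` of `𝒳 ×_𝔈 𝒳` lies in `𝒟†_{≤n}` iff `1 ≤ n` (sharp form of
`first_inDaggerLe`). [cite: MochizukiAbsTopIII2015, Cor 3.7 p.86] -/
@[simp] theorem first_inDaggerLe_iff (m : ℤ) (n : ℕ) : (first m).InDaggerLe n ↔ 1 ≤ n := by
  simp [InDaggerLe, InDagger]

/-- Instance form: `□` lies in `𝒟†_{≤n}` iff `2 ≤ n` (sharp form of `box_inDaggerLe`).
[cite: MochizukiAbsTopIII2015, Cor 3.7 p.86] -/
@[simp] theorem box_inDaggerLe_iff (n : ℕ) : box.InDaggerLe n ↔ 2 ≤ n := by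
  simp [InDaggerLe, InDagger]

/-- Instance form: `𝒩` lies in `𝒟†_{≤n}` iff `3 ≤ n` (sharp form of `space_inDaggerLe`).
[cite: MochizukiAbsTopIII2015, Cor 3.7 p.86] -/
@[simp] theorem space_inDaggerLe_iff (n : ℕ) : space.InDaggerLe n ↔ 3 ≤ n := by
  simp [InDaggerLe, InDagger]

/-- Instance form: `𝔈` lies in `𝒟†_{≤n}` iff `4 ≤ n`. [cite: MochizukiAbsTopIII2015, Cor 3.7 p.86] -/
@[simp] theorem galois_inDaggerLe_iff (n : ℕ) : galois.InDaggerLe n ↔ 4 ≤ n := by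
  simp [InDaggerLe, InDagger]

/-- Instance form: `𝔈` lies in `𝒟†_{≤n}` for `n ≥ 4` — the fourth sibling of `first_inDaggerLe`,
`box_inDaggerLe`, `space_inDaggerLe` (`BiAnabelianDiagrams.lean`).
[cite: MochizukiAbsTopIII2015, Cor 3.7 p.86] -/
theorem galois_inDaggerLe {n : ℕ} (h : 4 ≤ n) : galois.InDaggerLe n :=
  (galois_inDaggerLe_iff n).2 h

/-- `𝒟†_{≤0}` has no vertex (rows are numbered from `1`). [cite: MochizukiAbsTopIII2015, Cor 3.7 p.86] -/
@[simp] theorem not_inDaggerLe_zero (a : Cor37Vertex) : ¬ a.InDaggerLe 0 :=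
  fun h => not_inDDaggerLe_zero a h.2

/-- TRUE closed instance of F-0393: `𝒟†_{≤4} = 𝒟†` — print, Cor 3.7 (i) p. 87: "`𝒟† = 𝒟†_{≤4}`";
`𝒟†` has four rows. [cite: MochizukiAbsTopIII2015, Cor 3.7 (i) p.87] -/
theorem inDaggerLe_four_iff_inDagger (a : Cor37Vertex) : a.InDaggerLe 4 ↔ a.InDagger :=
  ⟨fun h => h.1, fun h => ⟨h, row_le_four a⟩⟩

/-- For EVERY `n`, not all vertices of `Γ⃗_{𝒟*}` lie in `𝒟†_{≤n}`: the core vertex never does.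
[cite: MochizukiAbsTopIII2015, Cor 3.7 p.87] -/
theorem not_forall_inDaggerLe_of (n : ℕ) : ¬ ∀ a : Cor37Vertex, a.InDaggerLe n :=
  fun h => not_ref_inDaggerLe n (h ref)

/-- **FACT-LIST F-0393: universal closure REFUTED.** `InDaggerLe` is a membership predicate, not a
claim; its one-step-unfolded universal closure "every vertex lies in every `𝒟†_{≤n}`" is false —
witness the core vertex `ref` of `𝒟‡` (at any `n`), or `n = 0`.
[cite: MochizukiAbsTopIII2015, Cor 3.7 p.86] -/
theorem not_forall_inDaggerLe : ¬ ∀ (n : ℕ) (a : Cor37Vertex), a.InDaggerLe n :=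
  fun h => not_forall_inDaggerLe_of 0 (h 0)

/-- The `ℤ`-translation of Cor 3.7 (v) preserves each `𝒟†_{≤n}` (it preserves rows and fixes the
core vertex). [cite: MochizukiAbsTopIII2015, Cor 3.7 (v) p.88] -/
theorem inDaggerLe_shiftObj_iff (k : ℤ) (n : ℕ) (a : Cor37Vertex) :
    (shiftObj k a).InDaggerLe n ↔ a.InDaggerLe n := by
  cases a <;> simp [shiftObj]

end Cor37Vertex

/-! ## Edges: the sub-diagrams lose no incoming arrow -/

namespace Cor37Edge

open Cor37Vertex

/-- `𝒟‡_{≤n}` (equivalently `𝒟*_{≤n}`) is closed under SOURCES of edges of `Γ⃗_{𝒟*}`: an arrow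
ending in the first `n` rows starts there (edges never decrease the row, `row_monotone`).
[cite: MochizukiAbsTopIII2015, Cor 3.7 p.87] -/
theorem source_inDDaggerLe {a b : Cor37Vertex} (e : Cor37Edge.{w} a b) {n : ℕ}
    (hb : b.InDDaggerLe n) : a.InDDaggerLe n :=
  Nat.le_trans (row_monotone e) hb

/-- `𝒟†_{≤n}` is closed under sources of edges of `𝒟†`: the sub-diagram of the first `n` rows of
`𝒟†` (convention of Cor 3.6 p. 79, "determined by the first `n` … rows", in force in Cor 3.7 "in the
notation and conventions of Corollary 3.6", p. 86) loses no incoming arrow of `𝒟†`.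
[cite: MochizukiAbsTopIII2015, Cor 3.7 p.86] -/
theorem source_inDaggerLe {a b : Cor37Vertex} (e : Cor37Edge.{w} a b) (he : e.InDagger) {n : ℕ}
    (hb : b.InDaggerLe n) : a.InDaggerLe n :=
  ⟨(inDagger_endpoints e he).1, Nat.le_trans (inDagger_endpoints e he).2.2 hb.2⟩

/-- The edges of `𝒟†` are edges of `𝒟‡` (`𝒟‡` = `𝒟†` with the arrows `π_⋎` appended).
[cite: MochizukiAbsTopIII2015, Cor 3.7 p.87] -/
theorem InDagger.inDDagger {a b : Cor37Vertex} {e : Cor37Edge.{w} a b} (he : e.InDagger) :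
    e.InDDagger := by
  cases e <;> simp_all [InDagger, InDDagger]

/-- An edge of `𝒟†` out of the pre-nexus side `Γ⃗_{<□}` either stays in the first row (`log_𝒳`) or
ends at the nexus (`pr_⋎`): within `𝒟†`, row 1 sees the rest of the diagram only through `□`.
[cite: MochizukiAbsTopIII2015, Cor 3.7 (v) p.88] -/
theorem InDagger.belowBox_or_eq_box_of_belowBox {a b : Cor37Vertex} {e : Cor37Edge.{w} a b}
    (he : e.InDagger) (ha : a.BelowBox) : b.BelowBox ∨ b = box := by
  cases e <;> simp_all [InDagger]

end Cor37Edge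

end Literature.AnabelianGeometry.AbsoluteAnabelian.AbsTopIII
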